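import Mathlib
import Summits.MatrixMultiplication.Statement
import Summits.MatrixMultiplication.MatrixMultiplication.Theorems.GraphEquationsSystems

/-!
# GraphEquations — exponent one forces reducedness (the first rung of multiplicity reduction)

For a correct equation system `E` for the graph `W_n` of `n × n` matrix multiplication whose test
ideal `J_E` contains `g · 𝕀(W_n)` for a polynomial `g` with `g(x) ≠ 0` at some `x ∈ W_n`
(Loewy exponent one off the hypersurface `g = 0`), the `C`-Jacobian of the tests has full rank
`n²` at `x`: differentiating `g · (c_il − Σ_k a_ik b_kl) = Σ_s q_s t_s` with respect to the
`C`-variables and evaluating at `x` (where every test and every generator vanishes) gives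
`g(x) · Id = Q(x) · J_C(x)`. Consequently exponent-one admissible families are generically reduced
(`exponentOneReduced`), the provable-now rung `ExponentOneReduced` of the line «exponent ladder»
for `MultiplicityReduction` (sources: Bürgisser–Clausen–Shokrollahi 1997, Problem 16.3 and §4.1;
the Jacobian criterion is classical commutative algebra).
-/

set_option linter.dupNamespace false

namespace Summit.MatrixMultiplication.MatrixMultiplication.Theorems.GraphEquations

open MvPolynomial

variable {n : ℕ}

/-- The generator `c_il − Σ_k a_ik b_kl` vanishes on the graph. -/
theorem generator_mem_vanishingIdeal (i l : Fin n) :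
    (X (Sum.inr (i, l)) -
        ∑ k : Fin n, X (Sum.inl (Sum.inl (i, k))) * X (Sum.inl (Sum.inr (k, l))) :
      MvPolynomial (GraphVars n) ℂ) ∈ MvPolynomial.vanishingIdeal ℂ (mmGraph n) := by
  rw [MvPolynomial.mem_vanishingIdeal_iff]
  intro x hx
  simp [hx i l]

/-- The generator vanishes at every point of the graph. -/
theorem eval_generator_eq_zero {x : GraphVars n → ℂ} (hx : x ∈ mmGraph n) (i l : Fin n) :
    MvPolynomial.eval x (X (Sum.inr (i, l)) -
        ∑ k : Fin n, X (Sum.inl (Sum.inl (i, k))) * X (Sum.inl (Sum.inr (k, l))) :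
      MvPolynomial (GraphVars n) ℂ) = 0 := by
  simp [hx i l]

/-- The `C`-partial derivatives of the generator: `∂/∂c_p (c_il − Σ_k a_ik b_kl) = [p = (i,l)]`. -/
theorem pderiv_inr_generator (p : Fin n × Fin n) (i l : Fin n) :
    MvPolynomial.pderiv (Sum.inr p) (X (Sum.inr (i, l)) -
        ∑ k : Fin n, X (Sum.inl (Sum.inl (i, k))) * X (Sum.inl (Sum.inr (k, l))) :
      MvPolynomial (GraphVars n) ℂ) = if p = (i, l) then 1 else 0 := by
  classical
  simp [map_sum, Derivation.leibniz, MvPolynomial.pderiv_X, Pi.single_apply, eq_comm]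

/-- The test set of `E` is the range of `s ↦ testPoly (tests.get s)`. -/
theorem tests_set_eq_range (E : EqSystem n) :
    {p | ∃ j ∈ E.tests, p = E.testPoly j} =
      Set.range (fun s : Fin E.tests.length => E.testPoly (E.tests.get s)) := by
  ext p
  constructor
  · rintro ⟨j, hj, rfl⟩
    obtain ⟨s, hs⟩ := List.mem_iff_get.1 hj
    exact ⟨s, congrArg E.testPoly hs⟩
  · rintro ⟨s, rfl⟩
    exact ⟨E.tests.get s, List.get_mem _ _, rfl⟩

/-- **Jacobian criterion at exponent one.** If `E` is correct, `x ∈ W_n`, `g(x) ≠ 0` and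
`g · 𝕀(W_n) ⊆ J_E`, then `E` is reduced at `x`. -/
theorem reducedAt_of_span_mul_vanishingIdeal_le {E : EqSystem n} (hE : E.Correct)
    {g : MvPolynomial (GraphVars n) ℂ} {x : GraphVars n → ℂ} (hx : x ∈ mmGraph n)
    (hgx : MvPolynomial.eval x g ≠ 0)
    (hle : Ideal.span {g} * MvPolynomial.vanishingIdeal ℂ (mmGraph n) ≤
      Ideal.span {p | ∃ j ∈ E.tests, p = E.testPoly j}) :
    E.ReducedAt x := by
  classical
  -- membership of `g * generator` in the span of the tests
  have hmem : ∀ il : Fin n × Fin n,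
      g * (X (Sum.inr (il.1, il.2)) -
        ∑ k : Fin n, X (Sum.inl (Sum.inl (il.1, k))) * X (Sum.inl (Sum.inr (k, il.2)))) ∈
        Ideal.span (Set.range (fun s : Fin E.tests.length => E.testPoly (E.tests.get s))) := by
    intro il
    rw [← tests_set_eq_range E]
    exact hle (Ideal.mul_mem_mul (Ideal.mem_span_singleton_self g)
      (generator_mem_vanishingIdeal il.1 il.2))
  choose q hq using fun il : Fin n × Fin n => (Ideal.mem_span_range_iff_exists_fun).1 (hmem il)
  -- tests vanish at `x`
  have ht0 : ∀ s : Fin E.tests.length, MvPolynomial.eval x (E.testPoly (E.tests.get s)) = 0 :=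
    fun s => hE.eval_testPoly_eq_zero hx (List.get_mem _ _)
  -- entrywise: `Σ_s q_{il,s}(x) · ∂t_s/∂c_p (x) = g(x) · [il = p]`
  have key' : ∀ il p : Fin n × Fin n,
      (∑ s : Fin E.tests.length, MvPolynomial.eval x (q il s) * (E.jacobianC x) s p) =
        MvPolynomial.eval x g * (if il = p then 1 else 0) := by
    intro il p
    have h := congrArg (fun f => MvPolynomial.eval x (MvPolynomial.pderiv (Sum.inr p) f)) (hq il)
    simp only [map_sum, Derivation.leibniz, smul_eq_mul, map_add, map_mul, ht0, zero_mul,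
      add_zero, pderiv_inr_generator, eval_generator_eq_zero hx, apply_ite (MvPolynomial.eval x),
      map_one, map_zero] at h
    have hJ : ∀ s : Fin E.tests.length, (E.jacobianC x) s p =
        MvPolynomial.eval x (MvPolynomial.pderiv (Sum.inr p) (E.testPoly (E.tests.get s))) :=
      fun s => rfl
    simp only [hJ]
    refine h.trans ?_
    obtain ⟨i, l⟩ := il
    by_cases hp : p = (i, l)
    · subst hp; simp
    · simp [hp, Ne.symm hp]
  -- the matrix identity `Q(x) · J_C(x) = g(x) · Id`
  have key : (Matrix.of fun (il : Fin n × Fin n) (s : Fin E.tests.length) =>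
        MvPolynomial.eval x (q il s)) * E.jacobianC x =
      (MvPolynomial.eval x g) • (1 : Matrix (Fin n × Fin n) (Fin n × Fin n) ℂ) := by
    ext il p
    rw [Matrix.mul_apply, Matrix.smul_apply, Matrix.one_apply, smul_eq_mul]
    simpa only [Matrix.of_apply] using key' il p
  -- rank count
  unfold EqSystem.ReducedAt
  apply le_antisymm
  · calc (E.jacobianC x).rank ≤ Fintype.card (Fin n × Fin n) :=
        Matrix.rank_le_card_width _
      _ = n * n := by simp
  · have hunit : IsUnit ((MvPolynomial.eval x g) •
        (1 : Matrix (Fin n × Fin n) (Fin n × Fin n) ℂ)) := by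
      rw [← Algebra.algebraMap_eq_smul_one]
      exact (IsUnit.mk0 _ hgx).map _
    have hrank := Matrix.rank_of_isUnit _ hunit
    simp only [Fintype.card_prod, Fintype.card_fin] at hrank
    calc n * n = ((Matrix.of fun (il : Fin n × Fin n) (s : Fin E.tests.length) =>
          MvPolynomial.eval x (q il s)) * E.jacobianC x).rank := by rw [key, hrank]
      _ ≤ (E.jacobianC x).rank := Matrix.rank_mul_le_right _ _

/-- **Exponent one forces generic reducedness** (the rung `ExponentOneReduced` of the exponent
ladder for multiplicity reduction): if for every `n ≥ 1` there is a correct system of cost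
`O(n^β)` whose test ideal contains `g_n · 𝕀(W_n)` for some `g_n ∉ 𝕀(W_n)`, then
`EqAdmissibleRed β`. -/
theorem exponentOneReduced (β : ℝ)
    (h : ∃ c : ℝ, ∀ n : ℕ, 1 ≤ n → ∃ E : EqSystem n, E.Correct ∧
      (∃ g : MvPolynomial (GraphVars n) ℂ,
        g ∉ MvPolynomial.vanishingIdeal ℂ (mmGraph n) ∧
        Ideal.span {g} * MvPolynomial.vanishingIdeal ℂ (mmGraph n) ≤
          Ideal.span {p | ∃ j ∈ E.tests, p = E.testPoly j}) ∧
      (E.cost : ℝ) ≤ c * (n : ℝ) ^ β) :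
    EqAdmissibleRed β := by
  obtain ⟨c, hc⟩ := h
  refine ⟨c, fun n hn => ?_⟩
  obtain ⟨E, hE, ⟨g, hg, hle⟩, hcost⟩ := hc n hn
  rw [MvPolynomial.mem_vanishingIdeal_iff] at hg
  push Not at hg
  obtain ⟨x, hx, hgx⟩ := hg
  have hgx' : MvPolynomial.eval x g ≠ 0 := by
    simpa [MvPolynomial.coe_aeval_eq_eval] using hgx
  exact ⟨E, hE, ⟨x, hx, reducedAt_of_span_mul_vanishingIdeal_le hE hx hgx' hle⟩, hcost⟩

/-- The rung in the exact shape of the route item `ExponentOneReduced`. -/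
theorem exponentOneReduced_holds :
    ∀ β : ℝ, (∃ c : ℝ, ∀ n : ℕ, 1 ≤ n → ∃ E : EqSystem n, E.Correct ∧
      (∃ g : MvPolynomial (GraphVars n) ℂ,
        g ∉ MvPolynomial.vanishingIdeal ℂ (mmGraph n) ∧
        Ideal.span {g} * MvPolynomial.vanishingIdeal ℂ (mmGraph n) ≤
          Ideal.span {p | ∃ j ∈ E.tests, p = E.testPoly j}) ∧
      (E.cost : ℝ) ≤ c * (n : ℝ) ^ β) → EqAdmissibleRed β :=
  exponentOneReduced

end Summit.MatrixMultiplication.MatrixMultiplication.Theorems.GraphEquations
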